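import Mathlib
import HarnessLib
import Literature.MathematicalPhysics.QuantumLattice.KohnLuttinger
import Literature.MathematicalPhysics.QuantumLattice.KohnLuttingerFermiCurvePolar
import Literature.MathematicalPhysics.QuantumLattice.KohnLuttingerLindhardMeasurable
import Summits.HubbardSuperconductivity.HubbardSuperconductivity.Theorems.WeakCouplingBCSWcbcsKohnLuttingerB1gReduction
import Summits.HubbardSuperconductivity.HubbardSuperconductivity.Theorems.WeakCouplingBCSKlSublatticeLindhard

/-!
# The sublattice cover pushes the Fermi-curve measure of the `t'` band to that of the `t` band
# («sublattice-duality» discharge, part 4; cell gate-hubbard-kl, seat p4 g20)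

For `ε' = squareDispersion 0 1`, `ε = squareDispersion 1 0` and the folded cover `Φ = fold ∘ A` (`klslCover`):

* §8 `klsl_gradient_squareDispersion` (general `t`–`t'` gradient), `klsl_norm_gradient_nnn`: `‖∇ε'(k)‖ = √2 ‖∇ε(A k)‖`,
  and the density-of-states identity `‖∇ε'(k)‖⁻¹ = (√2)⁻¹ ‖∇ε(A k + c)‖⁻¹` for lattice translations `c`;
* §9 `klsl_map_add_densityMeasure`: each affine piece pushes `μH[1]·‖∇ε'‖⁻¹` to `½ μH[1]·‖∇ε‖⁻¹`
  (arc length `× (√2)⁻¹`, density `× (√2)⁻¹`); `klsl_fermiCurve_nnn_eq`: `F' = BZ ∩ Φ⁻¹ F`; and the main theorem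
  **`klsl_map_cover_fermiCurveMeasure`: `Φ_* σ[ε', μ] = σ[ε, μ]` for every `μ`** (the transport engine
  `klsl_map_cover_of_affine` of part 3 with `T = F`), with the integral / `MemLp` transport corollaries
  `klsl_integral_comp_cover`, `klsl_memLp_comp_cover` used by the channel files (K1, K2, S0).

Honest framing: exact measure transport between two free-band objects; nothing here asserts a margin at any `t'`, the
window, `K₃` or superconductivity; a Kohn–Luttinger `O(U²)` channel statement is not ODLRO.
-/

noncomputable section

set_option linter.dupNamespace false

namespace Summit.HubbardSuperconductivity.HubbardSuperconductivity.Theorems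

open MeasureTheory Real Set Literature.MathematicalPhysics.QuantumLattice
open scoped ENNReal Pointwise

/-! ### §8 The Fermi velocity of the `t'` band against that of the `t` band along `A` -/

/-- **`∇ε_{t,s}(k) = (2 sin k₀ (t + 2s cos k₁), 2 sin k₁ (t + 2s cos k₀))`** for the general `t`–`t'` band
(general-`t` twin of `klph_hasGradientAt_squareDispersion`). [folklore] -/
theorem klsl_hasGradientAt_squareDispersion (t s : ℝ) (k : Momentum) :
    HasGradientAt (squareDispersion t s)
      (WithLp.toLp 2 ![2 * sin (k 0) * (t + 2 * s * cos (k 1)), 2 * sin (k 1) * (t + 2 * s * cos (k 0))]) k := by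
  rw [hasGradientAt_iff_hasFDerivAt]
  set P0 : Momentum →L[ℝ] ℝ := PiLp.proj 2 (fun _ : Fin 2 => ℝ) (0 : Fin 2) with hP0
  set P1 : Momentum →L[ℝ] ℝ := PiLp.proj 2 (fun _ : Fin 2 => ℝ) (1 : Fin 2) with hP1
  have hc0 : HasDerivAt Real.cos (-Real.sin (k 0)) (P0 k) := Real.hasDerivAt_cos (k 0)
  have hc1 : HasDerivAt Real.cos (-Real.sin (k 1)) (P1 k) := Real.hasDerivAt_cos (k 1)
  have h0 : HasFDerivAt (Real.cos ∘ ⇑P0) (-Real.sin (k 0) • P0) k := hc0.comp_hasFDerivAt k P0.hasFDerivAt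
  have h1 : HasFDerivAt (Real.cos ∘ ⇑P1) (-Real.sin (k 1) • P1) k := hc1.comp_hasFDerivAt k P1.hasFDerivAt
  have h := ((h0.add h1).const_mul (-2 * t : ℝ)).sub ((h0.mul h1).const_mul (4 * s))
  have hfun : squareDispersion t s = fun q : Momentum =>
      (-2 * t : ℝ) * (Real.cos ∘ ⇑P0 + Real.cos ∘ ⇑P1) q - 4 * s * ((Real.cos ∘ ⇑P0) q * (Real.cos ∘ ⇑P1) q) := by
    funext q; simp [squareDispersion, hP0, hP1]; ring
  rw [hfun]
  refine h.congr_fderiv ?_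
  ext q
  rw [InnerProductSpace.toDual_apply_apply]
  simp [hP0, hP1, PiLp.inner_apply, Fin.sum_univ_two]
  ring

/-- `∇ε_{t,s}(k)` as a vector. [folklore] -/
theorem klsl_gradient_squareDispersion (t s : ℝ) (k : Momentum) :
    gradient (squareDispersion t s) k =
      WithLp.toLp 2 ![2 * sin (k 0) * (t + 2 * s * cos (k 1)), 2 * sin (k 1) * (t + 2 * s * cos (k 0))] :=
  (klsl_hasGradientAt_squareDispersion t s k).gradient

/-- The squared Fermi speed of the pure `t'` band: `‖∇ε'(k)‖² = 16 (sin² k₀ cos² k₁ + cos² k₀ sin² k₁)`. [folklore] -/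
theorem klsl_norm_gradient_nnn_sq (k : Momentum) :
    ‖gradient (squareDispersion 0 1) k‖ ^ 2 = 16 * (sin (k 0) ^ 2 * cos (k 1) ^ 2 + cos (k 0) ^ 2 * sin (k 1) ^ 2) := by
  rw [klsl_gradient_squareDispersion, EuclideanSpace.norm_eq, Real.sq_sqrt (Finset.sum_nonneg fun i _ => sq_nonneg _),
    Fin.sum_univ_two]
  simp only [Matrix.cons_val_zero, Matrix.cons_val_one, Real.norm_eq_abs, sq_abs]
  ring

/-- The squared Fermi speed of the pure `t` band along `A`: `‖∇ε(A k)‖² = 8 (sin² k₀ cos² k₁ + cos² k₀ sin² k₁)`. [folklore] -/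
theorem klsl_norm_gradient_nn_klslA_sq (k : Momentum) :
    ‖gradient (squareDispersion 1 0) (klslA k)‖ ^ 2 = 8 * (sin (k 0) ^ 2 * cos (k 1) ^ 2 + cos (k 0) ^ 2 * sin (k 1) ^ 2) := by
  rw [gradient_squareDispersion, EuclideanSpace.norm_eq, Real.sq_sqrt (Finset.sum_nonneg fun i _ => sq_nonneg _),
    Fin.sum_univ_two]
  simp only [Matrix.cons_val_zero, Matrix.cons_val_one, Real.norm_eq_abs, sq_abs, klslA_apply_zero, klslA_apply_one,
    sin_add, sin_sub]
  ring

/-- **The Fermi speed scales by `√2` along the sublattice map**: `‖∇ε'(k)‖ = √2 ‖∇ε(A k)‖` (chain rule, `Aᵀ A = 2`).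
[folklore] -/
theorem klsl_norm_gradient_nnn (k : Momentum) :
    ‖gradient (squareDispersion 0 1) k‖ = Real.sqrt 2 * ‖gradient (squareDispersion 1 0) (klslA k)‖ := by
  have h1 := klsl_norm_gradient_nnn_sq k
  have h2 := klsl_norm_gradient_nn_klslA_sq k
  have hsq : ‖gradient (squareDispersion 0 1) k‖ ^ 2 = (Real.sqrt 2 * ‖gradient (squareDispersion 1 0) (klslA k)‖) ^ 2 := by
    rw [mul_pow, Real.sq_sqrt (by norm_num : (0:ℝ) ≤ 2), h1, h2]; ring
  exact (pow_left_inj₀ (norm_nonneg _) (by positivity) two_ne_zero).1 hsq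

/-- `∇ε` of the pure `t` band is `2π`-periodic: invariant under the lattice translations `(2πm, 2πn)`. [folklore] -/
theorem klsl_gradient_nn_add_vec (u : Momentum) {a b : ℝ} (ha : ∃ m : ℤ, a = m * (2 * π)) (hb : ∃ n : ℤ, b = n * (2 * π)) :
    gradient (squareDispersion 1 0) (u + klslVec a b) = gradient (squareDispersion 1 0) u := by
  obtain ⟨m, rfl⟩ := ha
  obtain ⟨n, rfl⟩ := hb
  rw [gradient_squareDispersion, gradient_squareDispersion]
  ext i; fin_cases i <;> simp [Real.sin_add_int_mul_two_pi]

/-- **The density of states transported**: `‖∇ε'(k)‖⁻¹ = (√2)⁻¹ · ‖∇ε(A k + c)‖⁻¹` for every lattice translation `c`,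
as `ℝ≥0∞`-densities. [folklore] -/
theorem klsl_density_nnn (k : Momentum) {a b : ℝ} (ha : ∃ m : ℤ, a = m * (2 * π)) (hb : ∃ n : ℤ, b = n * (2 * π)) :
    ENNReal.ofReal (‖gradient (squareDispersion 0 1) k‖⁻¹) =
      ENNReal.ofReal ((Real.sqrt 2)⁻¹) * ENNReal.ofReal (‖gradient (squareDispersion 1 0) (klslA k + klslVec a b)‖⁻¹) := by
  rw [klsl_gradient_nn_add_vec _ ha hb, klsl_norm_gradient_nnn, mul_inv,
    ENNReal.ofReal_mul (inv_nonneg.2 (Real.sqrt_nonneg 2))]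

/-! ### §9 The cover pushes the Fermi-curve measure of `ε'` forward to that of `ε` -/

/-- A measurable embedding pushes a pulled-back density forward: `e_* (ν · (g ∘ e)) = (e_* ν) · g`. [folklore] -/
theorem klsl_map_withDensity_comp {α β : Type*} [MeasurableSpace α] [MeasurableSpace β] {e : α → β}
    (he : MeasurableEmbedding e) (ν : Measure α) (g : β → ℝ≥0∞) :
    Measure.map e (ν.withDensity (g ∘ e)) = (Measure.map e ν).withDensity g := by
  ext s hs
  rw [Measure.map_apply he.measurable hs, withDensity_apply _ (he.measurable hs), withDensity_apply _ hs,
    Measure.restrict_map he.measurable hs, he.lintegral_map]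
  rfl

/-- `A` is a measurable embedding (a measurable self-equivalence of momentum space with inverse `A / 2`). [folklore] -/
theorem klsl_measurableEmbedding_klslA : MeasurableEmbedding klslA :=
  ({ toFun := klslA
     invFun := fun u => (2 : ℝ)⁻¹ • klslA u
     left_inv := fun k => by simp only [klslA_klslA, smul_smul]; norm_num
     right_inv := fun u => by
       show klslA ((2 : ℝ)⁻¹ • klslA u) = u
       rw [klslA_smul, klslA_klslA, smul_smul]; norm_num
     measurable_toFun := measurable_klslA
     measurable_invFun := measurable_klslA.const_smul _ } : Momentum ≃ᵐ Momentum).measurableEmbedding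

/-- The affine pieces `A + c` are measurable embeddings. [folklore] -/
theorem klsl_measurableEmbedding_add (c : Momentum) : MeasurableEmbedding fun k => klslA k + c :=
  (MeasurableEquiv.addRight c).measurableEmbedding.comp klsl_measurableEmbedding_klslA

/-- The gradient of the pure `t` band is measurable (it is continuous). [folklore] -/
theorem klsl_measurable_density_nn :
    Measurable fun u : Momentum => ENNReal.ofReal (‖gradient (squareDispersion 1 0) u‖⁻¹) :=
  ENNReal.measurable_ofReal.comp (continuous_gradient_squareDispersion.measurable.norm.inv)

/-- **Each affine piece pushes `μH[1]·‖∇ε'‖⁻¹` to `½ μH[1]·‖∇ε‖⁻¹`** (arc length shrinks by `√2`, the density of states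
by another `√2`). [folklore] -/
theorem klsl_map_add_densityMeasure {a b : ℝ} (ha : ∃ m : ℤ, a = m * (2 * π)) (hb : ∃ n : ℤ, b = n * (2 * π)) :
    Measure.map (fun k => klslA k + klslVec a b)
        ((μH[1] : Measure Momentum).withDensity fun k => ENNReal.ofReal (‖gradient (squareDispersion 0 1) k‖⁻¹)) =
      (2 : ℝ≥0∞)⁻¹ • (μH[1] : Measure Momentum).withDensity
        fun u => ENNReal.ofReal (‖gradient (squareDispersion 1 0) u‖⁻¹) := by
  set w : Momentum → ℝ≥0∞ := fun u => ENNReal.ofReal (‖gradient (squareDispersion 1 0) u‖⁻¹) with hw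
  have hdens : (fun k : Momentum => ENNReal.ofReal (‖gradient (squareDispersion 0 1) k‖⁻¹)) =
      ENNReal.ofReal ((Real.sqrt 2)⁻¹) • (w ∘ fun k => klslA k + klslVec a b) := by
    funext k
    simp only [Pi.smul_apply, Function.comp_apply, smul_eq_mul, hw]
    exact klsl_density_nnn k ha hb
  have hwm : Measurable (w ∘ fun k => klslA k + klslVec a b) :=
    klsl_measurable_density_nn.comp (measurable_klslA.add_const _)
  rw [hdens, withDensity_smul _ hwm, Measure.map_smul,
    klsl_map_withDensity_comp (klsl_measurableEmbedding_add _) _ w, map_klslA_add_hausdorff,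
    withDensity_smul_measure, smul_smul]
  congr 1
  rw [← ENNReal.ofReal_mul (inv_nonneg.2 (Real.sqrt_nonneg 2)), ← mul_inv,
    Real.mul_self_sqrt (by norm_num : (0:ℝ) ≤ 2), ENNReal.ofReal_inv_of_pos two_pos, ENNReal.ofReal_ofNat]

/-- The fold lands in the window on `[-3π, 3π)`. [folklore] -/
theorem klslWrap_mem_Ico {x : ℝ} (h1 : -(3 * π) ≤ x) (h2 : x < 3 * π) : klslWrap x ∈ Ico (-π) π := by
  unfold klslWrap
  split_ifs with h h'
  · exact ⟨by linarith, by linarith⟩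
  · exact ⟨not_lt.1 h, h'⟩
  · exact ⟨by linarith [not_lt.1 h'], by linarith⟩

/-- **The cover maps the zone into the zone.** [folklore] -/
theorem klslCover_mem_brillouinZone {k : Momentum} (hk : k ∈ brillouinZone) : klslCover k ∈ brillouinZone := by
  rw [klsl_mem_brillouinZone] at hk
  obtain ⟨⟨a, b⟩, c, d⟩ := hk
  intro i
  fin_cases i
  · simpa [klslCover] using klslWrap_mem_Ico (x := k 0 + k 1) (by linarith) (by linarith)
  · simpa [klslCover] using klslWrap_mem_Ico (x := k 0 - k 1) (by linarith) (by linarith)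

/-- **The Fermi curve of `ε'` is the zone part of the cover-preimage of the Fermi curve of `ε`.** [folklore] -/
theorem klsl_fermiCurve_nnn_eq (μ : ℝ) :
    fermiCurve (squareDispersion 0 1) μ = brillouinZone ∩ klslCover ⁻¹' fermiCurve (squareDispersion 1 0) μ := by
  ext k
  simp only [fermiCurve, mem_inter_iff, mem_setOf_eq, mem_preimage, klsl_squareDispersion_cover]
  constructor
  · rintro ⟨hk, h⟩; exact ⟨hk, klslCover_mem_brillouinZone hk, h⟩
  · rintro ⟨hk, -, h⟩; exact ⟨hk, h⟩

/-- The Fermi curve lies in the zone: `BZ ∩ F = F`. [folklore] -/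
theorem klsl_brillouinZone_inter_fermiCurve (ε : Momentum → ℝ) (μ : ℝ) :
    brillouinZone ∩ fermiCurve ε μ = fermiCurve ε μ :=
  inter_eq_right.2 fun _ hk => hk.1

/-- **The folded sublattice cover pushes the Fermi-curve measure of the `t'` band forward to that of the `t` band**:
`Φ_* σ[squareDispersion 0 1, μ] = σ[squareDispersion 1 0, μ]` for every `μ` (two sheets, each carrying half: arc
length `× (√2)⁻¹`, density of states `× (√2)⁻¹`). [cite: RaghuKivelsonScalapino2010, §II (6) and (8)] -/
theorem klsl_map_cover_fermiCurveMeasure (μ : ℝ) :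
    Measure.map klslCover (fermiCurveMeasure (squareDispersion 0 1) μ) = fermiCurveMeasure (squareDispersion 1 0) μ := by
  have hF : MeasurableSet (fermiCurve (squareDispersion 1 0) μ) :=
    measurableSet_fermiCurve (measurable_squareDispersion 1 0) μ
  have hF' : MeasurableSet (fermiCurve (squareDispersion 0 1) μ) :=
    measurableSet_fermiCurve (measurable_squareDispersion 0 1) μ
  have h := klsl_map_cover_of_affine
    (ν' := (μH[1] : Measure Momentum).withDensity fun k => ENNReal.ofReal (‖gradient (squareDispersion 0 1) k‖⁻¹))
    (ν₀ := (μH[1] : Measure Momentum).withDensity fun u => ENNReal.ofReal (‖gradient (squareDispersion 1 0) u‖⁻¹))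
    (fun a b ha hb => klsl_map_add_densityMeasure ha hb) hF
  rw [← klsl_fermiCurve_nnn_eq, klsl_brillouinZone_inter_fermiCurve, restrict_withDensity hF',
    restrict_withDensity hF] at h
  exact h

/-- The cover as a measure-preserving map `(ℝ², σ') → (ℝ², σ)` between the two Fermi-curve measures. [folklore] -/
theorem klsl_measurePreserving_cover_fermi (μ : ℝ) :
    MeasurePreserving klslCover (fermiCurveMeasure (squareDispersion 0 1) μ) (fermiCurveMeasure (squareDispersion 1 0) μ) :=
  ⟨measurable_klslCover, klsl_map_cover_fermiCurveMeasure μ⟩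

/-- **Integrals against the Fermi-curve measure transport along the cover**: `∫ f ∘ Φ dσ' = ∫ f dσ` for every `f` that is
a.e.-strongly measurable for `σ` (no injectivity needed: this is `integral_map`). [folklore] -/
theorem klsl_integral_comp_cover {E : Type*} [NormedAddCommGroup E] [NormedSpace ℝ E] (μ : ℝ) {f : Momentum → E}
    (hf : AEStronglyMeasurable f (fermiCurveMeasure (squareDispersion 1 0) μ)) :
    ∫ k, f (klslCover k) ∂fermiCurveMeasure (squareDispersion 0 1) μ = ∫ u, f u ∂fermiCurveMeasure (squareDispersion 1 0) μ := by
  rw [← klsl_map_cover_fermiCurveMeasure μ] at hf ⊢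
  exact (integral_map measurable_klslCover.aemeasurable hf).symm

/-- Square-integrable gap functions of `ε` pull back to square-integrable gap functions of `ε'`. [folklore] -/
theorem klsl_memLp_comp_cover (μ : ℝ) {f : Momentum → ℝ} {p : ℝ≥0∞}
    (hf : MemLp f p (fermiCurveMeasure (squareDispersion 1 0) μ)) :
    MemLp (f ∘ klslCover) p (fermiCurveMeasure (squareDispersion 0 1) μ) :=
  hf.comp_measurePreserving (klsl_measurePreserving_cover_fermi μ)

end Summit.HubbardSuperconductivity.HubbardSuperconductivity.Theorems

end
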